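import Mathlib
import HarnessLib
import Summits.HubbardSuperconductivity.HubbardSuperconductivity.Theorems.KLProgrammeC4aPPKernelTrueNumerator

/-!
# Route `KLProgramme` — crux C4a, S3 brick (B4) «(B4)-UMK1», «(M1)-TRUE-KERNEL» analytic half, part 1b: the FAR REGION `Λ < u` of the true numerator —
# closed forms and cancellation-respecting sizes of its level derivatives

Cell `gate-hubbard-kl`, seat hubbard-kl-k3c3-p1 (g15; row «δμ-flow with klAngularMean constant piece»).  Continuation of `…C4aPPKernelTrueNumerator` (objects `ppFreq`,
`ppTrueNumerator`, `ppTrueNumeratorDu`; stub (C) of stmt-HubbardSuperconductivity-20437, (U1) chain of hubbard-kl-k3c3-p3).  On the finer-line split's support the partner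
level satisfies `Λ < u`, so the partner weight is frozen at `1`:
* `uvWeightFn_ppFreq_far`, **`ppTrueNumeratorDu_of_far`** (`∂ᵤN = (2/β)Σ W(ωₙ,e)·(ωₙ²−u²)/(ωₙ²+u²)²` — no cutoff derivative);
* **`ppTrueNumeratorDu_of_far_of_far`** (`Λ < e` too: `∂ᵤN = (β/4)·sech²(βu/2)` EXACTLY — `Literature…tsum_matsubara_lorentzian_deriv`, the cancellation across frequencies);
* **`abs_ppTrueNumeratorDu_far_le`** — `|∂ᵤN(e,u)| ≤ (β/4)sech²(βu/2) + Λ/u²` for EVERY loop level `e` (defect `1 − W(ωₙ,e) ≤ 2Λ²/(ωₙ²+Λ²)`, shell mass `≤ Λ` by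
  `two_div_mul_tsum_shell_le` — no frequency counting);
* `ppTrueNumeratorDe_of_far`, **`abs_ppTrueNumeratorDe_far_le`** — `|∂ₑN(e,u)| ≤ (10B₁ + 5/2)/Λ` for every `e` (NO split of the loop weight below the shell),
  `ppTrueNumeratorDe_of_far_of_far` (`= (β/4)sech²(βe/2)` once `Λ < e`).
These are the `n₁, n₂` sizes feeding `…C4aAntidiagonalFlatnessL1.abs_integral_antidiagonal_flatness_le_of_L1` (note `M1-TRUE-KERNEL.md` §2, evidence #45: float targets
`sup|∂ₑN| ≈ 1/Λ`, `sup_{split}|∂ᵤN|·u² ≈ 0.25Λ`).  Pure real analysis; nothing asserts (C), K3 or superconductivity.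
References: BGM 2006 §2.1 (2.3), §2.4 [cite: BenfattoGiulianiMastropietro2006]; Salmhofer 1999 §4.2.5 (4.70)–(4.71) [cite: Salmhofer1999].
-/

noncomputable section

namespace Summit.HubbardSuperconductivity.HubbardSuperconductivity.Theorems.C4a

set_option linter.dupNamespace false -- summit = problem name (single-conjunct summit), D-0017

open Real Filter Set
open scoped Topology
open Literature.MathematicalPhysics.QuantumLattice Literature.Analysis.SpecialFunctions

/-! ## §3 The far region `Λ < u`: closed forms and cancellation-respecting sizes -/

/-- On the far region the partner weight is frozen: `Λ < u ⟹ W(ωₙ,u) = 1 ∧ W′(ωₙ,u) = 0` for every frequency. [cite: Salmhofer1999, §4.2.5 (4.71)] -/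
theorem uvWeightFn_ppFreq_far {β Λ u : ℝ} (hΛ : 0 < Λ) (hu : Λ < u) (n : ℕ) :
    uvWeightFn Λ (ppFreq β n) u = 1 ∧ uvWeightFnD1 Λ (ppFreq β n) u = 0 := by
  have h : Λ ^ 2 < u ^ 2 + ppFreq β n ^ 2 := by nlinarith [sq_nonneg (ppFreq β n), mul_pos hΛ (hΛ.trans hu)]
  have h1 := uvWeightFn_eq_one_of_gt hΛ h
  exact ⟨h1.1, h1.2.1⟩

/-- **`∂ᵤN` on the far region**: `Λ < u ⟹ ∂ᵤN(e,u) = (2/β)·Σₙ W(ωₙ,e)·(ωₙ²−u²)/(ωₙ²+u²)²` — no cutoff derivative. [cite: BenfattoGiulianiMastropietro2006, §2.4 (2.36)] -/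
theorem ppTrueNumeratorDu_of_far {β Λ u : ℝ} (hΛ : 0 < Λ) (hu : Λ < u) (e : ℝ) :
    ppTrueNumeratorDu β Λ e u = 2 / β * ∑' n : ℕ, uvWeightFn Λ (ppFreq β n) e * ((ppFreq β n ^ 2 - u ^ 2) / (ppFreq β n ^ 2 + u ^ 2) ^ 2) := by
  unfold ppTrueNumeratorDu
  congr 1
  refine tsum_congr fun n => ?_
  obtain ⟨h1, h2⟩ := uvWeightFn_ppFreq_far (β := β) hΛ hu n
  rw [h1, h2, zero_mul, zero_add, one_mul]

/-- **Both lines far ⟹ the thermal closed form**: `Λ < u`, `Λ < e` ⟹ `∂ᵤN(e,u) = (β/4)·sech²(βu/2)` EXACTLY (the cancellation across frequencies).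
[cite: BenfattoGiulianiMastropietro2006, §2.1 (2.2)-(2.5)] -/
theorem ppTrueNumeratorDu_of_far_of_far {β Λ e u : ℝ} (hβ : 0 < β) (hΛ : 0 < Λ) (hu : Λ < u) (he : Λ < e) :
    ppTrueNumeratorDu β Λ e u = β / 4 * sech (β * u / 2) ^ 2 := by
  rw [ppTrueNumeratorDu_of_far hΛ hu]
  have h1 : ∀ n : ℕ, uvWeightFn Λ (ppFreq β n) e * ((ppFreq β n ^ 2 - u ^ 2) / (ppFreq β n ^ 2 + u ^ 2) ^ 2) =
      (ppFreq β n ^ 2 - u ^ 2) / (ppFreq β n ^ 2 + u ^ 2) ^ 2 := fun n => by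
    rw [(uvWeightFn_ppFreq_far (β := β) hΛ he n).1, one_mul]
  simp_rw [h1]
  have h2 := tsum_matsubara_lorentzian_deriv hβ u
  simp only [ppFreq]
  rw [h2]
  field_simp
  ring

/-- **The far-region size of `∂ᵤN` for EVERY loop level**: `Λ < u ⟹ |∂ᵤN(e,u)| ≤ (β/4)·sech²(βu/2) + Λ/u²`
(`W = 1 − (1 − W)` on the FAR line only; the defect is shell-supported and counted by `two_div_mul_tsum_shell_le`). [cite: BenfattoGiulianiMastropietro2006, §2.4 (2.36)] -/
theorem abs_ppTrueNumeratorDu_far_le {β Λ u : ℝ} (hβ : 0 < β) (hΛ : 0 < Λ) (hu : Λ < u) (e : ℝ) :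
    |ppTrueNumeratorDu β Λ e u| ≤ β / 4 * sech (β * u / 2) ^ 2 + Λ / u ^ 2 := by
  have hu0 : 0 < u := hΛ.trans hu
  rw [ppTrueNumeratorDu_of_far hΛ hu]
  set L' : ℕ → ℝ := fun n => (ppFreq β n ^ 2 - u ^ 2) / (ppFreq β n ^ 2 + u ^ 2) ^ 2 with hL'
  have hω : ∀ n : ℕ, 0 < ppFreq β n := ppFreq_pos hβ
  -- summability of the pieces
  have hsL' : Summable L' := by
    refine Summable.of_norm_bounded (summable_one_div_ppFreq_sq_add_sq hβ 0) fun n => ?_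
    rw [Real.norm_eq_abs, hL', zero_pow two_ne_zero, add_zero]
    exact abs_lorentzian_deriv_le (hω n).ne' u
  have hdef : ∀ n : ℕ, |(1 - uvWeightFn Λ (ppFreq β n) e) * L' n| ≤ 2 * Λ ^ 2 / (ppFreq β n ^ 2 + Λ ^ 2) * (1 / u ^ 2) := fun n => by
    rw [abs_mul]
    obtain ⟨h0, h1⟩ := one_sub_uvWeightFn_le_shell hΛ (ppFreq β n) e
    rw [abs_of_nonneg h0]
    refine mul_le_mul h1 ?_ (abs_nonneg _) (by positivity)
    have h2 := abs_lorentzian_deriv_le_inv (ω := ppFreq β n) (x := u) (by positivity)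
    refine h2.trans ?_
    exact div_le_div_of_nonneg_left zero_le_one (by positivity) (by nlinarith [sq_nonneg (ppFreq β n)])
  have hsdef : Summable fun n : ℕ => (1 - uvWeightFn Λ (ppFreq β n) e) * L' n := by
    refine Summable.of_norm_bounded ((summable_one_div_ppFreq_sq_add_sq hβ Λ).mul_left (2 * Λ ^ 2 * (1 / u ^ 2))) fun n => ?_
    rw [Real.norm_eq_abs]
    refine (hdef n).trans (le_of_eq ?_)
    field_simp
  -- split `W = 1 − (1 − W)` on the far line
  have hsplit : ∑' n : ℕ, uvWeightFn Λ (ppFreq β n) e * L' n = (∑' n : ℕ, L' n) - ∑' n : ℕ, (1 - uvWeightFn Λ (ppFreq β n) e) * L' n := by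
    rw [← hsL'.tsum_sub hsdef]
    exact tsum_congr fun n => by ring
  have hmain : ∑' n : ℕ, L' n = β ^ 2 / 8 * sech (β * u / 2) ^ 2 := by
    have h := tsum_matsubara_lorentzian_deriv hβ u
    simp only [hL', ppFreq]
    exact h
  have hcorr : |∑' n : ℕ, (1 - uvWeightFn Λ (ppFreq β n) e) * L' n| ≤ (∑' n : ℕ, 2 * Λ ^ 2 / (ppFreq β n ^ 2 + Λ ^ 2)) * (1 / u ^ 2) := by
    rw [← tsum_mul_right]
    refine (norm_tsum_le_tsum_norm hsdef.norm).trans ?_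
    exact Summable.tsum_le_tsum (fun n => by rw [Real.norm_eq_abs]; exact hdef n) hsdef.norm
      (((summable_one_div_ppFreq_sq_add_sq hβ Λ).mul_left (2 * Λ ^ 2)).congr (fun n => by field_simp) |>.mul_right _)
  have hshell := two_div_mul_tsum_shell_le hβ hΛ
  have hβ2 : 0 < 2 / β := by positivity
  show |2 / β * ∑' n : ℕ, uvWeightFn Λ (ppFreq β n) e * L' n| ≤ β / 4 * sech (β * u / 2) ^ 2 + Λ / u ^ 2
  rw [hsplit, hmain, mul_sub, abs_le]
  have hA : 2 / β * (β ^ 2 / 8 * sech (β * u / 2) ^ 2) = β / 4 * sech (β * u / 2) ^ 2 := by field_simp; ring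
  have hB : |2 / β * ∑' n : ℕ, (1 - uvWeightFn Λ (ppFreq β n) e) * L' n| ≤ Λ / u ^ 2 := by
    rw [abs_mul, abs_of_pos hβ2]
    calc 2 / β * |∑' n : ℕ, (1 - uvWeightFn Λ (ppFreq β n) e) * L' n|
        ≤ 2 / β * ((∑' n : ℕ, 2 * Λ ^ 2 / (ppFreq β n ^ 2 + Λ ^ 2)) * (1 / u ^ 2)) := mul_le_mul_of_nonneg_left hcorr hβ2.le
      _ = (2 / β * ∑' n : ℕ, 2 * Λ ^ 2 / (ppFreq β n ^ 2 + Λ ^ 2)) * (1 / u ^ 2) := by ring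
      _ ≤ Λ * (1 / u ^ 2) := mul_le_mul_of_nonneg_right hshell (by positivity)
      _ = Λ / u ^ 2 := by ring
  have hsech : 0 ≤ β / 4 * sech (β * u / 2) ^ 2 := by positivity
  rw [hA]
  constructor <;> nlinarith [abs_le.1 hB, hsech]

/-- **`∂ₑN` on the far region as a series** (`Λ < u`): `∂ₑN(e,u) = (2/β)·Σₙ [W′(ωₙ,e)·(u/(ωₙ²+u²) + e/(ωₙ²+e²)) + W(ωₙ,e)·(ωₙ²−e²)/(ωₙ²+e²)²]`.
[cite: BenfattoGiulianiMastropietro2006, §2.4 (2.36)] -/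
theorem ppTrueNumeratorDe_of_far {β Λ u : ℝ} (hΛ : 0 < Λ) (hu : Λ < u) (e : ℝ) :
    ppTrueNumeratorDu β Λ u e = 2 / β * ∑' n : ℕ,
      (uvWeightFnD1 Λ (ppFreq β n) e * (u / (ppFreq β n ^ 2 + u ^ 2) + e / (ppFreq β n ^ 2 + e ^ 2)) +
        uvWeightFn Λ (ppFreq β n) e * ((ppFreq β n ^ 2 - e ^ 2) / (ppFreq β n ^ 2 + e ^ 2) ^ 2)) := by
  unfold ppTrueNumeratorDu
  congr 1
  refine tsum_congr fun n => ?_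
  rw [(uvWeightFn_ppFreq_far (β := β) hΛ hu n).1, one_mul]

/-- **The far-region size of `∂ₑN` for EVERY loop level**: `Λ < u ⟹ |∂ₑN(e,u)| ≤ (10B₁ + 5/2)/Λ` — the cutoff-derivative part by
`abs_uvWeightFnD1_mul_lorentzians_le`, the weighted Lorentzian-derivative part by `abs_uvWeightFn_mul_lorentzian_deriv_le` (NO split of the loop weight);
for `Λ < e` the exact value is `(β/4)·sech²(βe/2)` (`ppTrueNumeratorDu_of_far_of_far` with the roles exchanged). [cite: BenfattoGiulianiMastropietro2006, §2.4 (2.36)] -/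
theorem abs_ppTrueNumeratorDe_far_le {β Λ u : ℝ} (hβ : 0 < β) (hΛ : 0 < Λ) (hu : Λ < u) {B₁ : ℝ} (hB₁ : ∀ x, |deriv salmhoferCutoff x| ≤ B₁) (e : ℝ) :
    |ppTrueNumeratorDu β Λ u e| ≤ (10 * B₁ + 5 / 2) / Λ := by
  have hB0 := salmhoferB₁_nonneg hB₁
  have hω : ∀ n : ℕ, 0 < ppFreq β n := ppFreq_pos hβ
  rw [ppTrueNumeratorDe_of_far hΛ hu]
  set f : ℕ → ℝ := fun n => uvWeightFnD1 Λ (ppFreq β n) e * (u / (ppFreq β n ^ 2 + u ^ 2) + e / (ppFreq β n ^ 2 + e ^ 2)) +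
      uvWeightFn Λ (ppFreq β n) e * ((ppFreq β n ^ 2 - e ^ 2) / (ppFreq β n ^ 2 + e ^ 2) ^ 2) with hf
  have hbd : ∀ n : ℕ, |f n| ≤ (20 * B₁ + 5) * (1 / (ppFreq β n ^ 2 + Λ ^ 2)) := fun n => by
    have h1 := abs_uvWeightFnD1_mul_lorentzians_le hB₁ hΛ hu (hω n).ne' e
    have h2 := abs_uvWeightFn_mul_lorentzian_deriv_le hΛ (hω n).ne' e
    refine (abs_add_le _ _).trans ?_
    calc |uvWeightFnD1 Λ (ppFreq β n) e * (u / (ppFreq β n ^ 2 + u ^ 2) + e / (ppFreq β n ^ 2 + e ^ 2))| +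
          |uvWeightFn Λ (ppFreq β n) e * ((ppFreq β n ^ 2 - e ^ 2) / (ppFreq β n ^ 2 + e ^ 2) ^ 2)|
        ≤ 20 * B₁ / (ppFreq β n ^ 2 + Λ ^ 2) + 5 / (ppFreq β n ^ 2 + Λ ^ 2) := add_le_add h1 h2
      _ = (20 * B₁ + 5) * (1 / (ppFreq β n ^ 2 + Λ ^ 2)) := by field_simp
  have hsb : Summable fun n : ℕ => (20 * B₁ + 5) * (1 / (ppFreq β n ^ 2 + Λ ^ 2)) := (summable_one_div_ppFreq_sq_add_sq hβ Λ).mul_left _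
  have hsf : Summable f := Summable.of_norm_bounded hsb fun n => by rw [Real.norm_eq_abs]; exact hbd n
  have htsum : |∑' n : ℕ, f n| ≤ (20 * B₁ + 5) * (β * Real.tanh (β * Λ / 2) / (4 * Λ)) := by
    rw [← tsum_one_div_ppFreq_sq_add_sq hβ hΛ.ne', ← tsum_mul_left]
    refine (norm_tsum_le_tsum_norm hsf.norm).trans ?_
    exact Summable.tsum_le_tsum (fun n => by rw [Real.norm_eq_abs]; exact hbd n) hsf.norm hsb
  have ht : Real.tanh (β * Λ / 2) ≤ 1 := (Real.tanh_lt_one _).le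
  have hβ2 : 0 < 2 / β := by positivity
  rw [abs_mul, abs_of_pos hβ2]
  calc 2 / β * |∑' n : ℕ, f n| ≤ 2 / β * ((20 * B₁ + 5) * (β * Real.tanh (β * Λ / 2) / (4 * Λ))) := mul_le_mul_of_nonneg_left htsum hβ2.le
    _ = (10 * B₁ + 5 / 2) / Λ * Real.tanh (β * Λ / 2) := by field_simp; ring
    _ ≤ (10 * B₁ + 5 / 2) / Λ * 1 := mul_le_mul_of_nonneg_left ht (by positivity)
    _ = (10 * B₁ + 5 / 2) / Λ := mul_one _

/-- **Both lines far, loop-level version**: `Λ < u`, `Λ < e` ⟹ `∂ₑN(e,u) = (β/4)·sech²(βe/2)`. [cite: BenfattoGiulianiMastropietro2006, §2.1 (2.2)-(2.5)] -/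
theorem ppTrueNumeratorDe_of_far_of_far {β Λ e u : ℝ} (hβ : 0 < β) (hΛ : 0 < Λ) (hu : Λ < u) (he : Λ < e) :
    ppTrueNumeratorDu β Λ u e = β / 4 * sech (β * e / 2) ^ 2 :=
  ppTrueNumeratorDu_of_far_of_far hβ hΛ he hu

end Summit.HubbardSuperconductivity.HubbardSuperconductivity.Theorems.C4a

end
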